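/-
Copyright (c) 2026 the pub-hodgecm-mathlib formalisation cell (harness21).  Prover seat hodgecm-mathlib-K2Liu-p10 (g0), Track B «K2-LIT»,
#184♮ = hLiu418 = `stmt-HodgeConjecture-24832`; LEAD F0P6-plan (g12) 07:19:04Z «(CR) conversion OWNED by H1-C — the Cayley transport of `𝔭⁻`»,
SIGS-RoadI-v3 §Hol row H1-C ∕ H1-E (CR-Cartan).  THEOREMS ONLY (no `def`, no `instance`, no named-fact hypothesis, no `sorry`).
-/
import Summits.HodgeConjecture.HodgeConjecture.Theorems.K2LiuHermitianTubeFrame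
import HarnessLib

/-!
# Crux `HLiu418`, Road I, organ Hol-1 (H1-C), Lie-algebra layer: the CAYLEY transport of `𝔨`, `𝔭⁺`, `𝔭⁻` from the diagonal frame
# `1 ⊕ −1` (G2-W1's `uFormGroup (Fin n) (Fin n)` letters) to the tube frame `J`, and `𝔭⁻_tube = {[[N, −iN], [−iN, −N]]}`

Cell `hodgecm-mathlib`, crux item hLiu418 = `stmt-HodgeConjecture-24832` (helper lane, count-neutral).  With the UNNORMALISED Cayley unit
`T₁ = (1 1; i·1 −i·1)` and `T₁' = (1 −i·1; 1 i·1)` (so `T₁⁻¹ = ½ T₁'`; these are the `t ≡ 2` letters `d = e = 1` of ★ `K2LiuHermitianTubeFrame`):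
* §1 `T₁ T₁' = 2 = T₁' T₁`, `T₁ (½T₁') = 1 = (½T₁') T₁`, `T₁ᴴ (i·J) T₁ = 2·(1 ⊕ −1)`; hence the group transport
  `g ↦ T₁ g (½T₁') : U(1 ⊕ −1) → {Pᴴ J P = J}` (`cayley_conj_mem_UJ`) and the Lie-algebra transport (general letters, `lie_conj_mem`):
  `Tᴴ K T = H`, `T T' = 1 = T' T`, `Yᴴ H + H Y = 0 ⇒ (T Y T')ᴴ K + K (T Y T') = 0`;
* §2 THE TRANSPORT FORMULAS (stated ×2 to stay integral): `T₁ (A 0; 0 B) T₁' = (A+B  −i(A−B); i(A−B)  A+B)` (`𝔨`),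
  `T₁ (0 N; 0 0) T₁' = (N iN; iN −N)` (`𝔭⁺`), **`T₁ (0 0; N 0) T₁' = (N −iN; −iN −N)`** (`𝔭⁻`): the tube `𝔭⁻` is
  `{[[N, −iN],[−iN, −N]]}` = the Cayley image of the LOWER-LEFT block — the letters in which H1-E (K2Liu-p11 (g0)) states (CR-Cartan)
  `D(μ b) = i·D(σ b)`; indeed `μ(b) − i·σ(b) = (b −ib; −ib −b) = T₁ (0 0; b 0) T₁'` (`mu_sub_I_smul_sigma_eq`), so «`D` kills `𝔭⁻_tube`»
  ⇔ (CR-Cartan) by linearity of `D`;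
* §3 consistency with the general frame of ★ `exists_tubeFrame`: `(D D; iED −iED) = T₁ · ½(D+ED  D−ED; D−ED  D+ED)` — the second
  factor is the monomial change from the `V ⊕ V⁻` frame `diag t ⊕ −diag t` to the signature-sorted frame, so the per-place frame of
  ★ `K2LiuHermitianTubeFrameArch` and G2-W1's diagonal frame induce THE SAME tube letters.
Sources: [Shimura1997, §§5–6]; [Knapp1986, Ch. VI §2 (Cayley transform, `𝔭^±`)].
HONEST LABEL.  Helper lemmas, count-neutral; `HC_CM` is proved only modulo the 7 printed citations (2 remaining named inputs:
hLiu418 = `stmt-HodgeConjecture-24832`, h413 = `stmt-HodgeConjecture-24833`) until rung 0 closes.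
-/

set_option autoImplicit false
set_option linter.dupNamespace false -- the mandated namespace repeats `HodgeConjecture.HodgeConjecture`

namespace Summit.HodgeConjecture.HodgeConjecture.Cruxes.HLiu418.K2LiuHermitianTubeFramePMinus

open Matrix Complex
open scoped MatrixGroups ComplexConjugate
open K2LiuHermitianTubeCocycle K2LiuHermitianTubeFrame

variable {l : Type*} [Fintype l] [DecidableEq l]

/-! ## 1. The Cayley unit -/

/-- `(i·1) X (i·1) = −X`. [folklore] -/
theorem I_smul_one_mul_mul_I_smul_one (X : Matrix l l ℂ) : (I • (1 : Matrix l l ℂ)) * X * (I • 1) = -X := by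
  rw [Matrix.smul_mul, Matrix.one_mul, Matrix.mul_smul, Matrix.mul_one, smul_smul, I_mul_I, neg_one_smul]

/-- `(i·1) X = i·X`, `X (i·1) = i·X`. [folklore] -/
theorem I_smul_one_mul (X : Matrix l l ℂ) : (I • (1 : Matrix l l ℂ)) * X = I • X ∧ X * (I • (1 : Matrix l l ℂ)) = I • X := by
  rw [Matrix.smul_mul, Matrix.one_mul, Matrix.mul_smul, Matrix.mul_one]; exact ⟨rfl, rfl⟩

/-- `T₁ T₁' = 2`. [cite: Shimura1997, §6] -/
theorem cayley_mul_cayley' :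
    (fromBlocks 1 1 (I • 1) (-(I • 1)) : Matrix (l ⊕ l) (l ⊕ l) ℂ) * fromBlocks 1 (-(I • 1)) 1 (I • 1) = (2 : ℂ) • 1 := by
  rw [fromBlocks_multiply, ← fromBlocks_one, fromBlocks_smul, smul_zero]
  simp only [Matrix.one_mul, Matrix.mul_one, Matrix.mul_neg, Matrix.neg_mul, (I_smul_one_mul (I • (1 : Matrix l l ℂ))).1,
    smul_smul, I_mul_I, neg_smul, one_smul, neg_neg, neg_add_cancel, add_neg_cancel, ← two_smul ℂ]

/-- `T₁' T₁ = 2`. [cite: Shimura1997, §6] -/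
theorem cayley'_mul_cayley :
    fromBlocks 1 (-(I • 1)) 1 (I • 1) * (fromBlocks 1 1 (I • 1) (-(I • 1)) : Matrix (l ⊕ l) (l ⊕ l) ℂ) = (2 : ℂ) • 1 := by
  rw [fromBlocks_multiply, ← fromBlocks_one, fromBlocks_smul, smul_zero]
  simp only [Matrix.mul_one, Matrix.mul_neg, Matrix.neg_mul, (I_smul_one_mul (I • (1 : Matrix l l ℂ))).1,
    smul_smul, I_mul_I, neg_smul, one_smul, neg_neg, ← two_smul ℂ]
  refine fromBlocks_inj.2 ⟨?_, ?_, ?_, ?_⟩ <;> abel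

/-- `T₁ (½T₁') = 1`. [cite: Shimura1997, §6] -/
theorem cayley_mul_cayleyInv :
    (fromBlocks 1 1 (I • 1) (-(I • 1)) : Matrix (l ⊕ l) (l ⊕ l) ℂ) * ((2 : ℂ)⁻¹ • fromBlocks 1 (-(I • 1)) 1 (I • 1)) = 1 := by
  rw [Matrix.mul_smul, cayley_mul_cayley', smul_smul, inv_mul_cancel₀ two_ne_zero, one_smul]

/-- `(½T₁') T₁ = 1`. [cite: Shimura1997, §6] -/
theorem cayleyInv_mul_cayley :
    ((2 : ℂ)⁻¹ • fromBlocks 1 (-(I • 1)) 1 (I • 1)) * (fromBlocks 1 1 (I • 1) (-(I • 1)) : Matrix (l ⊕ l) (l ⊕ l) ℂ) = 1 := by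
  rw [Matrix.smul_mul, cayley'_mul_cayley, smul_smul, inv_mul_cancel₀ two_ne_zero, one_smul]

/-- `T₁ᴴ (i·J) T₁ = 2·(1 ⊕ −1)`. [cite: Shimura1997, §6] -/
theorem cayley_conjTranspose_mul_smul_J_mul :
    (fromBlocks 1 1 (I • 1) (-(I • 1)) : Matrix (l ⊕ l) (l ⊕ l) ℂ)ᴴ * (I • Matrix.J l ℂ) * fromBlocks 1 1 (I • 1) (-(I • 1)) =
      (2 : ℂ) • fromBlocks 1 0 0 (-1) := by
  rw [Matrix.mul_smul, Matrix.smul_mul, fromBlocks_conjTranspose_mul_J_mul, fromBlocks_smul, fromBlocks_smul, smul_zero, smul_neg]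
  have hI2 : I * (2 * I) = -2 := by rw [mul_left_comm, I_mul_I]; ring
  simp only [conjTranspose_one, conjTranspose_neg, conjTranspose_smul, star_def, conj_I, Matrix.one_mul,
    neg_smul, sub_neg_eq_add, neg_neg, sub_self, smul_zero, neg_sub_left, ← two_smul ℂ, smul_smul, smul_neg, mul_neg,
    mul_one, neg_neg, hI2]

/-- **Group transport** `U(1 ⊕ −1) → {Pᴴ J P = J}` along the Cayley unit. [cite: Shimura1997, §6] -/
theorem cayley_conj_mem_UJ {g : Matrix (l ⊕ l) (l ⊕ l) ℂ} (hg : gᴴ * fromBlocks 1 0 0 (-1) * g = fromBlocks 1 0 0 (-1)) :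
    (fromBlocks 1 1 (I • 1) (-(I • 1)) * g * ((2 : ℂ)⁻¹ • fromBlocks 1 (-(I • 1)) 1 (I • 1)))ᴴ * Matrix.J l ℂ *
      (fromBlocks 1 1 (I • 1) (-(I • 1)) * g * ((2 : ℂ)⁻¹ • fromBlocks 1 (-(I • 1)) 1 (I • 1))) = Matrix.J l ℂ := by
  refine conj_mem_UJ cayley_conjTranspose_mul_smul_J_mul cayley_mul_cayleyInv ?_
  rw [Matrix.mul_smul, Matrix.smul_mul, hg]

/-- **Lie-algebra transport** (general letters): `Tᴴ K T = H`, `T T' = 1 = T' T`, `Yᴴ H + H Y = 0 ⇒ (T Y T')ᴴ K + K (T Y T') = 0`.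
[cite: Knapp1986, Ch. VI §2] -/
theorem lie_conj_mem {m : Type*} [Fintype m] [DecidableEq m] {T T' K H Y : Matrix m m ℂ} (hT : Tᴴ * K * T = H)
    (h1 : T * T' = 1) (h2 : T' * T = 1) (hY : Yᴴ * H + H * Y = 0) : (T * Y * T')ᴴ * K + K * (T * Y * T') = 0 := by
  have hK : K = T'ᴴ * H * T' := by
    rw [← hT]
    calc K = (T * T')ᴴ * K * (T * T') := by rw [h1, conjTranspose_one, Matrix.one_mul, Matrix.mul_one]
      _ = T'ᴴ * (Tᴴ * K * T) * T' := by rw [conjTranspose_mul]; simp only [Matrix.mul_assoc]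
  have h2' : Tᴴ * T'ᴴ = 1 := by rw [← conjTranspose_mul, h2, conjTranspose_one]
  rw [hK, conjTranspose_mul, conjTranspose_mul]
  calc T'ᴴ * (Yᴴ * Tᴴ) * (T'ᴴ * H * T') + T'ᴴ * H * T' * (T * Y * T')
      = T'ᴴ * Yᴴ * (Tᴴ * T'ᴴ) * H * T' + T'ᴴ * H * (T' * T) * Y * T' := by simp only [Matrix.mul_assoc]
    _ = T'ᴴ * (Yᴴ * H + H * Y) * T' := by rw [h2', h2, Matrix.mul_one, Matrix.mul_one]; noncomm_ring
    _ = 0 := by rw [hY, Matrix.mul_zero, Matrix.zero_mul]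

/-- The Cayley instance of the Lie transport: `Yᴴ (1 ⊕ −1) + (1 ⊕ −1) Y = 0 ⇒ (T₁ Y ½T₁')ᴴ J + J (T₁ Y ½T₁') = 0`.
[cite: Knapp1986, Ch. VI §2] -/
theorem cayley_lie_conj_mem {Y : Matrix (l ⊕ l) (l ⊕ l) ℂ} (hY : Yᴴ * fromBlocks 1 0 0 (-1) + fromBlocks 1 0 0 (-1) * Y = 0) :
    (fromBlocks 1 1 (I • 1) (-(I • 1)) * Y * ((2 : ℂ)⁻¹ • fromBlocks 1 (-(I • 1)) 1 (I • 1)))ᴴ * Matrix.J l ℂ +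
      Matrix.J l ℂ * (fromBlocks 1 1 (I • 1) (-(I • 1)) * Y * ((2 : ℂ)⁻¹ • fromBlocks 1 (-(I • 1)) 1 (I • 1))) = 0 := by
  have hT : (fromBlocks 1 1 (I • 1) (-(I • 1)) : Matrix (l ⊕ l) (l ⊕ l) ℂ)ᴴ * Matrix.J l ℂ * fromBlocks 1 1 (I • 1) (-(I • 1)) =
      (-(2 * I)) • fromBlocks 1 0 0 (-1) := by
    have h := cayley_conjTranspose_mul_smul_J_mul (l := l)
    rw [Matrix.mul_smul, Matrix.smul_mul] at h
    have h' := congrArg (fun M => (-I) • M) h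
    simp only [smul_smul, neg_mul, I_mul_I, neg_neg, one_smul] at h'
    rw [h', mul_comm I 2]
  refine lie_conj_mem hT cayley_mul_cayleyInv cayleyInv_mul_cayley ?_
  rw [Matrix.mul_smul, Matrix.smul_mul, ← smul_add, hY, smul_zero]

/-! ## 2. The transport formulas for `𝔨`, `𝔭⁺`, `𝔭⁻` (integral form `T₁ X T₁'`) -/

/-- **`𝔨`**: `T₁ (A 0; 0 B) T₁' = (A+B  −i(A−B); i(A−B)  A+B)`. [cite: Knapp1986, Ch. VI §2] -/
theorem cayley_conj_blockDiag (A B : Matrix l l ℂ) :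
    fromBlocks 1 1 (I • 1) (-(I • 1)) * fromBlocks A 0 0 B * fromBlocks 1 (-(I • 1)) 1 (I • 1) =
      fromBlocks (A + B) (-(I • (A - B))) (I • (A - B)) (A + B) := by
  rw [fromBlocks_multiply, fromBlocks_multiply]
  simp only [Matrix.one_mul, Matrix.mul_zero, add_zero, zero_add, Matrix.mul_one, Matrix.neg_mul, Matrix.mul_neg,
    (I_smul_one_mul _).1, (I_smul_one_mul _).2, smul_smul, I_mul_I, neg_one_smul, neg_neg, smul_zero, smul_neg,
    sub_eq_add_neg, smul_add]
  refine fromBlocks_inj.2 ⟨rfl, ?_, ?_, ?_⟩ <;> module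

/-- **`𝔭⁺`**: `T₁ (0 N; 0 0) T₁' = (N iN; iN −N)`. [cite: Knapp1986, Ch. VI §2] -/
theorem cayley_conj_upperRight (N : Matrix l l ℂ) :
    fromBlocks 1 1 (I • 1) (-(I • 1)) * fromBlocks 0 N 0 0 * fromBlocks 1 (-(I • 1)) 1 (I • 1) =
      fromBlocks N (I • N) (I • N) (-N) := by
  rw [fromBlocks_multiply, fromBlocks_multiply]
  simp only [Matrix.one_mul, Matrix.mul_zero, add_zero, zero_add, Matrix.mul_one, Matrix.mul_neg, (I_smul_one_mul _).1,
    (I_smul_one_mul _).2, smul_smul, I_mul_I, neg_one_smul, smul_zero, neg_zero]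

/-- **`𝔭⁻`: `T₁ (0 0; N 0) T₁' = (N −iN; −iN −N)`** — the tube `𝔭⁻` is `{[[N, −iN],[−iN, −N]]}`, the Cayley image of the LOWER-LEFT block.
[cite: Knapp1986, Ch. VI §2] -/
theorem cayley_conj_lowerLeft (N : Matrix l l ℂ) :
    fromBlocks 1 1 (I • 1) (-(I • 1)) * fromBlocks 0 0 N 0 * fromBlocks 1 (-(I • 1)) 1 (I • 1) =
      fromBlocks N (-(I • N)) (-(I • N)) (-N) := by
  rw [fromBlocks_multiply, fromBlocks_multiply]
  simp only [Matrix.one_mul, Matrix.mul_zero, add_zero, zero_add, Matrix.mul_one, Matrix.neg_mul, Matrix.mul_neg,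
    (I_smul_one_mul _).1, (I_smul_one_mul _).2, smul_smul, I_mul_I, neg_one_smul, smul_zero, smul_neg, neg_neg]

/-- The honest conjugate: `T₁ X (½T₁') = ½ (T₁ X T₁')`. [folklore] -/
theorem conj_cayleyInv_eq_half (X : Matrix (l ⊕ l) (l ⊕ l) ℂ) :
    fromBlocks 1 1 (I • 1) (-(I • 1)) * X * ((2 : ℂ)⁻¹ • fromBlocks 1 (-(I • 1)) 1 (I • 1)) =
      (2 : ℂ)⁻¹ • (fromBlocks 1 1 (I • 1) (-(I • 1)) * X * fromBlocks 1 (-(I • 1)) 1 (I • 1)) := by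
  rw [Matrix.mul_smul]

/-- **(CR-Cartan) letters**: `μ(b) − i·σ(b) = (b −ib; −ib −b) = T₁ (0 0; b 0) T₁'`, `μ(b) = (b 0; 0 −b)`, `σ(b) = (0 b; b 0)` (H1-E's letters).
[cite: Knapp1986, Ch. VI §2] -/
theorem mu_sub_I_smul_sigma_eq (b : Matrix l l ℂ) :
    (fromBlocks b 0 0 (-b) : Matrix (l ⊕ l) (l ⊕ l) ℂ) - I • fromBlocks 0 b b 0 =
      fromBlocks 1 1 (I • 1) (-(I • 1)) * fromBlocks 0 0 b 0 * fromBlocks 1 (-(I • 1)) 1 (I • 1) := by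
  rw [cayley_conj_lowerLeft, fromBlocks_smul, smul_zero, sub_eq_add_neg, fromBlocks_neg, fromBlocks_add]
  simp only [neg_zero, add_zero, zero_add]

/-! ## 3. Consistency: the general frame factors through the Cayley unit -/

/-- **`T = T₁ · M`** with `M = ½ (D+ED  D−ED; D−ED  D+ED)`: the frame of ★ `exists_tubeFrame` is the Cayley unit times the monomial
swap-and-scale frame. [cite: Shimura1997, §6] -/
theorem frame_eq_cayley_mul_monomial (D E : Matrix l l ℂ) :
    (fromBlocks D D (I • (E * D)) (-(I • (E * D))) : Matrix (l ⊕ l) (l ⊕ l) ℂ) =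
      fromBlocks 1 1 (I • 1) (-(I • 1)) *
        ((2 : ℂ)⁻¹ • fromBlocks (D + E * D) (D - E * D) (D - E * D) (D + E * D)) := by
  rw [Matrix.mul_smul, fromBlocks_multiply]
  simp only [Matrix.one_mul, Matrix.neg_mul, (I_smul_one_mul _).1, fromBlocks_smul]
  refine fromBlocks_inj.2 ⟨?_, ?_, ?_, ?_⟩ <;> module

end Summit.HodgeConjecture.HodgeConjecture.Cruxes.HLiu418.K2LiuHermitianTubeFramePMinus
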